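import Summits.PneNP.PneNP.Theses.RamseyUncertifiable

/-!
# Disproof work file — crux `RegularResolutionRung` (stmt-PneNP-9818, route `RamseyUncertifiable`)

cdisprove seats `refuter-cdisprove-stmt-PneNP-9818-g2-0` (cycle 1, 2026-08-15) and `…-g3-0` (cycle 2,
2026-08-16, § Targets). Everything below is `sorry`-free (axioms `propext`, `Classical.choice`,
`Quot.sound`).

## The crux, read back
`∃ ε > 0, ∃ n₀, ∀ n ≥ n₀, ∀ G : SimpleGraph (Fin n), ∀ π₁ π₂` — if `π₁` is a REGULAR resolution
refutation of the unary clique formula `Clique(G, k)` and `π₂` one of `Clique(Ḡ, k)`,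
`k = Nat.clog 2 (n^2) = ⌈2 log₂ n⌉`, then `n ^ (ε · log₂ n) ≤ max |π₁| |π₂|`.
`cliqueCNF n k adj` below is the `let cnf` body verbatim (`regularResolutionRung_iff_restated` is
`Iff.rfl`). Clauses: block-member `⋁_v x_{i,v}` (`i < k`), functionality `¬x_{i,u} ∨ ¬x_{i,v}`
(`u < v`), edge axioms `¬x_{i,u} ∨ ¬x_{j,v}` for `i ≠ j`, `adj u v = false` (this INCLUDES `u = v`,
`Adj` being irreflexive); variable `x_{i,v} ↦ i·n + v`; literal `(x, true)` is positive.
Satisfiable iff `G` has a `k`-clique, so the statement only bites on `k`-Ramsey graphs (both `G`,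
`Ḡ` `k`-clique-free), which exist for every `n ≥ 3` (Erdős). Elaboration quirk (harmless): in the
first two clause families the binders range over the coerced list `↑(List.finRange n) : List ℕ`.

## Findings
* (a) LOAD-BEARING — both sides of the `max` are needed:
  `regularResolutionRung_false_without_complement` : dropping `π₂` is FALSE (witness `G = ⊥`,
  `n = 2^m`: `Clique(∅ₙ, k)` has a regular refutation with `2n² + n + 2` lines,
  `exists_short_regular_refutation`); `regularResolutionRung_false_without_graph` : dropping `π₁`
  is FALSE (witness `G = ⊤`). Any proof must use that `G` is genuinely Ramsey (both sides).
  `both_sides_separately_short`: for every `n` each side separately admits the `O(n²)` refutation —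
  by different graphs; the `max` is exactly where Ramsey's theorem enters.
* (a') Regularity hypothesis: dropping `IsRegular` gives crux `ResolutionUncertainty`
  (stmt-PneNP-9816), itself OPEN (LPRT13 §1.1, ABdRLNR21 §9) — cannot be shown load-bearing by a
  counterexample today. Strengthening regular → tree-like gives a THEOREM (LPRT13 Thm 4: every
  c-Ramsey `G` needs tree-like refutations of the unary formula of size `n^{Ω(log n)}`).
* (b) CALIBRATION / tightness (paper, not formalised): brute-force DPLL gives tree-like (hence
  regular) refutations of `Clique(G,k)` with `≤ 4·n^{ω(G)+1} ≤ 4n·n^{2log₂ n}` lines, so the crux can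
  only hold with `ε ≤ 2`; the `∃ ε` is necessarily small. Formalising `¬(crux with ε := 3)` needs
  `RamseyAbundant` (stmt-PneNP-9821) + a generic DPLL→resolution construction; not attempted.
* (c) STRENGTHENINGS considered: `min` in place of `max` ⇔ ABdRLNR21 §9 verbatim ("for a Ramsey
  graph G … Clique(G,⌈2log₂n⌉) requires (regular) resolution refutations of n^{Ω(log n)}?") — open,
  implies the crux (the Ramsey class is complement-closed). The crux itself ⇔ (up to a factor 2 in
  size) the regular-resolution length of LPRT's unary HOMOGENEOUS-SET formula `Ψ'_G` (restrict the
  selector bit either way / recombine), i.e. "LPRT13 Thm 4 with tree-like replaced by regular".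
* (d) Targets: none yet (payload.targets = []). Landed: `Theorems/RegularResolutionRung/Negative/
  EmptyGraphLines.lean` (p70260, accepted) and `…/Negative/OneSidedFalse.lean` (p70678, accepted: validity,
  regularity, the two `_false_without_` theorems) — importable by ideators/planners. Adversarial lead for cycle 2 (no stub yet): the
  natural transfer stub "every ⌈2log₂n⌉-Ramsey graph has an `n^{Ω(1)}`-vertex induced subgraph that is
  clique-dense in the sense of ABdRLNR21 Def 6.3" — property 2 (the hitting-set form of mostly-dense)
  looks refutable by planting `O(log n)`-size dead-end cliques in `G(n,½)` (Ramsey-ness survives since the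
  slack at `c = 2` is `≈ 2log₂log₂ n`); to be made precise if such a stub is filed.
* (e) SLACK at `c = 2` (prover-facing, heuristic): for `G(n,½)`, `ω ≈ 2log₂ n − 2log₂log₂ n`, so a
  typical Ramsey graph tolerates only `≈ 2log₂log₂ n` added isolated/twin vertices; but Ramsey-ness at this
  threshold is NOT known to force `G(n,½)`-like statistics deterministically (random graphs are only
  conjecturally extremal for `R(k,k)`), and an induced subgraph on `m = n^{1/2}` vertices is merely
  `(4log₂ m + 1)`-Ramsey, which allows densities anywhere in `(0.293, 0.707)` (compare `G(m,p)`: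
  `hom ≈ 2 log_{1/max(p,1-p)} m`). A clique-denseness transfer must therefore be proved from Ramsey-ness
  alone at polynomial scales, where only Erdős–Szemerédi / Prömel–Rödl type information is available.
* (f) TARGETS, cycle 2 (g3 seat, 2026-08-16; § Targets below): three checked skeletons, no pick yet.
  drc gen-1 `stub_fractional` (FRAC v1) FALSE in Lean modulo host (`Targets.stubFractional_false_of_host`,
  sub-radar planted holes; p75452; the gen-2 planner restated it independently); gen-2 FRAC₂ (spread-cover)
  RESISTS aligned, padded and hypergraph-matching designs (BD caps total junk per context at `< M` while
  non-triviality keeps contexts `> M`; tools `Targets.cover_cost_ge_of_spread`, `Targets.frac2_trivial`);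
  `sound-path-bottleneck`'s `stub_biDenseTrapSparse` FALSE ON PAPER — padded transversal traps beat its
  absolute minimal-trap SUM for every admissible parameter tuple (`StubBiDenseTrapSparseRefutation.md`;
  repair: cover form, relative demand); `indelible-zero-banks`' `stub_bankEntropy` ⇔ C⁺, calibrated by
  blow-ups of `G(m^{β'},½)`: `ε ≤ 2β²`. (B'): the lead's affine points/hyperplanes witness (which killed the
  picked line `sound-path-bottleneck` at 02:35) does NOT kill FRAC v1/FRAC₂ — their GLOBAL `(r,q)`-density
  precondition fails for `W = Ω`; `drc-selfrich-core` gen 2 is not 'dead on arrival'.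
* WHY IT RESISTS cheap refutation: (1) explicit `⌈2log₂n⌉`-Ramsey graphs are not known (Erdős'
  problem), so no explicit counterexample family can even be written down; (2) lopsided Ramsey
  graphs do not help: Erdős–Szekeres `n < C(ω+α, ω)` with `α < 2log₂ n` forces `ω ≥ 0.2·log₂ n`,
  so brute force is `n^{Θ(log n)}` on BOTH sides and no side is trivially `n^{o(log n)}`;
  (3) the FPT upper bounds of ABdRLNR21 §3 (Prop. 3.1: size `≤ |I(G)|·k²·n²`, `I(G)` = common
  neighbourhoods of cliques; `(k-1)`-colourable and bounded-homomorphism graphs) need `χ(G) < k` or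
  few clique-neighbourhoods, while a `k`-Ramsey graph has `χ ≥ n/(2log₂ n)` and `n^{Ω(log n)}`
  cliques (greedy count using Erdős–Szemerédi density); (4) weakening adds no power to regular
  resolution (splice-out keeps pivots along paths), so the tree's `IsRegular` + `weaken` rule is the
  textbook system; (5) no negative result in print: ABdRLNR21 §9 poses the question as open.
  Sources read: arXiv:2012.09476 pp. 4, 9–11, 13, 24; arXiv:1303.3166 pp. 5–6.

## Generic tools provers may reuse
`isResDerivation_map_range` (validity of an index-presented derivation), `isRegular_of_strictRank`
(regularity from a strictly decreasing rank), `block_mem` / `edge_mem` (axioms of `cliqueCNF`).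
-/

set_option linter.dupNamespace false

namespace Summit.PneNP.PneNP.Cruxes.RegularResolutionRung.Disproof

open Literature.Computability.MetaComplexity Literature.Computability.Complexity

/-- The unary clique CNF `Clique(G,k)` exactly as inlined (`let cnf`) in the route file. -/
def cliqueCNF (n k : ℕ) (adj : Fin n → Fin n → Bool) : CNF ℕ :=
  ((List.range k).map fun i => (List.finRange n).map fun v => (i * n + (v : ℕ), true)) ++ ((List.range k).flatMap fun i => (List.finRange n).flatMap fun u => (List.finRange n).flatMap fun v => if u < v then [[(i * n + (u : ℕ), false), (i * n + (v : ℕ), false)]] else []) ++ ((List.range k).flatMap fun i => (List.range k).flatMap fun j => (List.finRange n).flatMap fun u => (List.finRange n).flatMap fun v => if i ≠ j ∧ adj u v = false then [[(i * n + (u : ℕ), false), (j * n + (v : ℕ), false)]] else [])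

/-- A derivation presented as `(List.range L).map f` is valid as soon as every line `f a` is an axiom, or is justified by lines of smaller index. -/
theorem isResDerivation_map_range {φ : CNF ℕ} {f : ℕ → ResLine ℕ} {L : ℕ}
    (hinit : ∀ a < L, (f a).rule = .initial → (f a).clause ∈ φ.clauseFinsets)
    (hres : ∀ a < L, ∀ i j v, (f a).rule = .resolve i j v →
      i < a ∧ j < a ∧ IsResolvent (f i).clause (f j).clause v (f a).clause)
    (hweak : ∀ a < L, ∀ i, (f a).rule = .weaken i → i < a ∧ (f i).clause ⊆ (f a).clause) :
    IsResDerivation φ ((List.range L).map f) := by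
  intro a ha
  have haL : a < L := by simpa using ha
  have hget : ((List.range L).map f)[a]'ha = f a := by simp
  have htake : ((List.range L).map f).take a = (List.range a).map f := by
    rw [← List.map_take, List.take_range, Nat.min_eq_left haL.le]
  rw [hget, htake]
  unfold IsValidResLine
  split
  · next heq => exact hinit a haL heq
  · next i j v heq =>
    obtain ⟨hi, hj, hr⟩ := hres a haL i j v heq
    refine ⟨by simpa using hi, by simpa using hj, ?_⟩
    simpa using hr
  · next i heq =>
    obtain ⟨hi, hsub⟩ := hweak a haL i heq
    refine ⟨by simpa using hi, ?_⟩
    simpa using hsub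

/-- Regularity from a strictly decreasing rank: if every premise has strictly smaller rank than its conclusion and resolution lines with equal pivots have equal rank, then no DAG path resolves a variable twice. -/
theorem isRegular_of_strictRank {ν : Type*} (π : List (ResLine ν)) (rank : ℕ → ℕ)
    (hlt : ∀ a (ha : a < π.length), ∀ b ∈ (π[a]).premises, rank b < rank a)
    (hinj : ∀ a (ha : a < π.length) a' (ha' : a' < π.length) v,
      (π[a]).rule.pivot? = some v → (π[a']).rule.pivot? = some v → rank a = rank a') :
    IsRegular π := by
  intro p hp
  obtain ⟨hlen, hchain⟩ := hp
  have hlen' : ∀ i ∈ p, i < π.length := by simpa using hlen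
  have hch : List.IsChain (fun a b => rank b < rank a) p := by
    refine List.IsChain.imp_of_mem_imp (fun a b ha _ hab => ?_) hchain
    have haπ : a < π.length := hlen' a ha
    have : (π.map ResLine.premises).getD a [] = (π[a]).premises := by
      simp [List.getD_eq_getElem?_getD, haπ]
    rw [this] at hab
    exact hlt a haπ b hab
  let _inst : Trans (fun a b => rank b < rank a) (fun a b => rank b < rank a)
      (fun a b => rank b < rank a) := ⟨fun h₁ h₂ => lt_trans h₂ h₁⟩
  have hpw : List.Pairwise (fun a b => rank b < rank a) p := hch.pairwise
  unfold pivotsAlong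
  refine List.Pairwise.filterMap _ (fun a a' hlt' v hv v' hv' => ?_)
    (List.Pairwise.imp_of_mem (fun {a b} ha hb h => (⟨ha, hb, h⟩ : a ∈ p ∧ b ∈ p ∧ rank b < rank a)) hpw)
  obtain ⟨ha, ha', hr⟩ := hlt'
  have haπ := hlen' a ha
  have ha'π := hlen' a' ha'
  have hva : (π[a]).rule.pivot? = some v := by simpa [haπ] using hv
  have hva' : (π[a']).rule.pivot? = some v' := by simpa [ha'π] using hv'
  intro hvv
  subst hvv
  have := hinj a haπ a' ha'π v hva hva'
  omega

/-! ## The explicit short regular refutation of `Clique(∅ₙ, k)` -/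

/-- Positive block-0 literals `x_{0,u}` for `lo ≤ u < n` (variable `u`). -/
def pos0 (lo n : ℕ) : Finset (Literal ℕ) := (Finset.Ico lo n).image fun u => (u, true)
/-- Positive block-1 literals `x_{1,v}` for `lo ≤ v < n` (variable `n + v`). -/
def pos1 (lo n : ℕ) : Finset (Literal ℕ) := (Finset.Ico lo n).image fun v => (n + v, true)
/-- The edge axiom `¬x_{0,t} ∨ ¬x_{1,s}` of the empty graph. -/
def clE (n t s : ℕ) : Finset (Literal ℕ) := {(t, false), (n + s, false)}
/-- The intermediate clause `x_{0,t+1} ∨ … ∨ x_{0,n-1} ∨ ¬x_{1,s}`. -/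
def clR (n s t : ℕ) : Finset (Literal ℕ) := pos0 (t + 1) n ∪ {(n + s, false)}

/-- Membership in `pos0`. -/
theorem mem_pos0 {lo n : ℕ} {x : Literal ℕ} : x ∈ pos0 lo n ↔ lo ≤ x.1 ∧ x.1 < n ∧ x.2 = true := by
  obtain ⟨a, b⟩ := x
  simp only [pos0, Finset.mem_image, Finset.mem_Ico, Prod.mk.injEq]
  constructor
  · rintro ⟨u, ⟨h1, h2⟩, rfl, rfl⟩; exact ⟨h1, h2, rfl⟩
  · rintro ⟨h1, h2, rfl⟩; exact ⟨a, ⟨h1, h2⟩, rfl, rfl⟩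

/-- Membership in `pos1`. -/
theorem mem_pos1 {lo n : ℕ} {x : Literal ℕ} : x ∈ pos1 lo n ↔ n + lo ≤ x.1 ∧ x.1 < n + n ∧ x.2 = true := by
  obtain ⟨a, b⟩ := x
  simp only [pos1, Finset.mem_image, Finset.mem_Ico, Prod.mk.injEq]
  constructor
  · rintro ⟨u, ⟨h1, h2⟩, rfl, rfl⟩; exact ⟨by omega, by omega, rfl⟩
  · rintro ⟨h1, h2, rfl⟩; exact ⟨a - n, ⟨by omega, by omega⟩, by omega, rfl⟩

/-- Erasing the first literal of `pos0`. -/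
theorem pos0_erase {lo n : ℕ} : (pos0 lo n).erase (lo, true) = pos0 (lo + 1) n := by
  ext ⟨a, b⟩
  simp only [Finset.mem_erase, mem_pos0, ne_eq, Prod.mk.injEq]
  cases b <;> simp
  omega

/-- Erasing the first literal of `pos1`. -/
theorem pos1_erase {lo n : ℕ} : (pos1 lo n).erase (n + lo, true) = pos1 (lo + 1) n := by
  ext ⟨a, b⟩
  simp only [Finset.mem_erase, mem_pos1, ne_eq, Prod.mk.injEq]
  cases b <;> simp
  omega

/-- `pos0 n n` is empty. -/
theorem pos0_self (n : ℕ) : pos0 n n = ∅ := by simp [pos0]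
/-- `pos1 n n` is empty. -/
theorem pos1_self (n : ℕ) : pos1 n n = ∅ := by simp [pos1]

/-- Erasing the pivot from `clR`-shaped clauses. -/
theorem clR_erase {n s lo : ℕ} :
    (pos0 lo n ∪ {(n + s, false)}).erase (lo, true) = pos0 (lo + 1) n ∪ {(n + s, false)} := by
  rw [Finset.erase_union_distrib, pos0_erase, Finset.erase_eq_of_notMem]
  simp

/-- Erasing the pivot from an edge axiom leaves the unit `¬x_{1,s}`. -/
theorem clE_erase {n t s : ℕ} (ht : t < n) : (clE n t s).erase (t, false) = {(n + s, false)} := by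
  unfold clE
  rw [Finset.erase_insert]
  simp only [Finset.mem_singleton, Prod.mk.injEq, and_true]
  omega

/-- The lines of the refutation of `Clique(∅ₙ,k)`, by index: `0`: `⋁_v x_{1,v}`; `1`: `⋁_u x_{0,u}`; `2 + (sn+t)`: edge axiom `¬x_{0,t} ∨ ¬x_{1,s}`; `2 + n² + (sn+t)`: `clR n s t`, resolvent on `x_{0,t}` of the previous line (line `1` if `t = 0`) with line `2 + (sn+t)`; `2 + 2n² + s`: `x_{1,s+1} ∨ … ∨ x_{1,n-1}`, resolvent on `x_{1,s}` of the previous line (line `0` if `s = 0`) with the unit `¬x_{1,s}` (line `2 + n² + (sn + n-1)`); the last line is `∅`. -/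
def line (n a : ℕ) : ResLine ℕ :=
  if a = 0 then ⟨pos1 0 n, .initial⟩
  else if a = 1 then ⟨pos0 0 n, .initial⟩
  else if a < 2 + n * n then ⟨clE n ((a - 2) % n) ((a - 2) / n), .initial⟩
  else if a < 2 + 2 * (n * n) then
    ⟨clR n ((a - (2 + n * n)) / n) ((a - (2 + n * n)) % n),
      .resolve (if (a - (2 + n * n)) % n = 0 then 1 else a - 1) (a - n * n) ((a - (2 + n * n)) % n)⟩
  else ⟨pos1 (a - (2 + 2 * (n * n)) + 1) n,
      .resolve (if a - (2 + 2 * (n * n)) = 0 then 0 else a - 1)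
        (2 + n * n + ((a - (2 + 2 * (n * n))) * n + (n - 1))) (n + (a - (2 + 2 * (n * n))))⟩

/-- The explicit refutation: `2 + 2n² + n` lines. -/
def refutation (n : ℕ) : List (ResLine ℕ) := (List.range (2 + 2 * (n * n) + n)).map (line n)

/-- Its length. -/
theorem length_refutation (n : ℕ) : (refutation n).length = 2 + 2 * (n * n) + n := by
  simp [refutation]

section lines
variable {n : ℕ}

/-- Line `0`. -/
theorem line_zero : line n 0 = ⟨pos1 0 n, .initial⟩ := by simp [line]
/-- Line `1`. -/
theorem line_one : line n 1 = ⟨pos0 0 n, .initial⟩ := by simp [line]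
/-- Lines of the edge-axiom region. -/
theorem line_E {a : ℕ} (h2 : 2 ≤ a) (h : a < 2 + n * n) :
    line n a = ⟨clE n ((a - 2) % n) ((a - 2) / n), .initial⟩ := by
  unfold line
  rw [if_neg (by omega), if_neg (by omega), if_pos h]
/-- Lines of the inner-chain region. -/
theorem line_R {a : ℕ} (h1 : 2 + n * n ≤ a) (h : a < 2 + 2 * (n * n)) :
    line n a = ⟨clR n ((a - (2 + n * n)) / n) ((a - (2 + n * n)) % n),
      .resolve (if (a - (2 + n * n)) % n = 0 then 1 else a - 1) (a - n * n) ((a - (2 + n * n)) % n)⟩ := by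
  unfold line
  rw [if_neg (by omega), if_neg (by omega), if_neg (by omega), if_pos h]
/-- Lines of the outer-chain region. -/
theorem line_T {a : ℕ} (h1 : 2 + 2 * (n * n) ≤ a) :
    line n a = ⟨pos1 (a - (2 + 2 * (n * n)) + 1) n,
      .resolve (if a - (2 + 2 * (n * n)) = 0 then 0 else a - 1)
        (2 + n * n + ((a - (2 + 2 * (n * n))) * n + (n - 1))) (n + (a - (2 + 2 * (n * n))))⟩ := by
  unfold line
  rw [if_neg (by omega), if_neg (by omega), if_neg (by omega), if_neg (by omega)]

/-- Base-`n` digits of `s n + t`. -/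
theorem digits_of {s t : ℕ} (ht : t < n) : (s * n + t) / n = s ∧ (s * n + t) % n = t := by
  have hn : 0 < n := by omega
  constructor
  · rw [Nat.add_comm, Nat.add_mul_div_right _ _ hn, Nat.div_eq_of_lt ht, Nat.zero_add]
  · rw [Nat.add_comm, Nat.add_mul_mod_self_right, Nat.mod_eq_of_lt ht]

/-- The inner-chain index of digits `s, t < n` lies in its region. -/
theorem idxR_lt {s t : ℕ} (hs : s < n) (ht : t < n) :
    2 + n * n + (s * n + t) < 2 + 2 * (n * n) := by
  have := Nat.mul_le_mul_right n hs
  rw [Nat.succ_mul] at this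
  omega

/-- Case analysis of an index `< 2 + 2n² + n` into the five regions. -/
theorem region_cases {a : ℕ} (hn : 1 ≤ n) (ha : a < 2 + 2 * (n * n) + n) :
    a = 0 ∨ a = 1 ∨ (∃ s t, s < n ∧ t < n ∧ a = 2 + (s * n + t)) ∨
      (∃ s t, s < n ∧ t < n ∧ a = 2 + n * n + (s * n + t)) ∨
      (∃ s, s < n ∧ a = 2 + 2 * (n * n) + s) := by
  have hpos : 0 < n := hn
  have split : ∀ b < n * n, ∃ s t, s < n ∧ t < n ∧ b = s * n + t := fun b hb =>
    ⟨b / n, b % n, Nat.div_lt_of_lt_mul hb, Nat.mod_lt _ hpos, by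
      have := Nat.div_add_mod b n; rw [Nat.mul_comm] at this; omega⟩
  rcases Nat.lt_or_ge a 2 with h | h
  · rcases (by omega : a = 0 ∨ a = 1) with rfl | rfl <;> simp
  rcases Nat.lt_or_ge a (2 + n * n) with h' | h'
  · obtain ⟨s, t, hs, ht, e⟩ := split (a - 2) (by omega)
    exact Or.inr (Or.inr (Or.inl ⟨s, t, hs, ht, by omega⟩))
  rcases Nat.lt_or_ge a (2 + 2 * (n * n)) with h'' | h''
  · obtain ⟨s, t, hs, ht, e⟩ := split (a - (2 + n * n)) (by omega)
    exact Or.inr (Or.inr (Or.inr (Or.inl ⟨s, t, hs, ht, by omega⟩)))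
  · exact Or.inr (Or.inr (Or.inr (Or.inr ⟨a - (2 + 2 * (n * n)), by omega, by omega⟩)))

/-- Edge-axiom line in digit form. -/
theorem lineE_spec {s t : ℕ} (hs : s < n) (ht : t < n) :
    line n (2 + (s * n + t)) = ⟨clE n t s, .initial⟩ := by
  have := idxR_lt hs ht
  rw [line_E (by omega) (by omega)]
  simp only [Nat.add_sub_cancel_left, (digits_of ht).1, (digits_of ht).2]

/-- Inner-chain line in digit form. -/
theorem lineR_spec {s t : ℕ} (hs : s < n) (ht : t < n) :
    line n (2 + n * n + (s * n + t)) =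
      ⟨clR n s t, .resolve (if t = 0 then 1 else 2 + n * n + (s * n + t) - 1) (2 + (s * n + t)) t⟩ := by
  have hlt := idxR_lt hs ht
  rw [line_R (by omega) (by omega)]
  have e4 : 2 + n * n + (s * n + t) - n * n = 2 + (s * n + t) := by omega
  simp only [Nat.add_sub_cancel_left, (digits_of ht).1, (digits_of ht).2, e4]

/-- Outer-chain line in digit form. -/
theorem lineT_spec (s : ℕ) :
    line n (2 + 2 * (n * n) + s) =
      ⟨pos1 (s + 1) n, .resolve (if s = 0 then 0 else 2 + 2 * (n * n) + s - 1)
        (2 + n * n + (s * n + (n - 1))) (n + s)⟩ := by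
  rw [line_T (by omega)]
  simp only [Nat.add_sub_cancel_left]

end lines


/-! ### Membership of the axioms used -/

section validity
variable {n : ℕ}

/-- The block-member clause of block `i < k` is an axiom of `cliqueCNF`. -/
theorem block_mem (k i : ℕ) (hi : i < k) (adj : Fin n → Fin n → Bool) :
    ((List.finRange n).map fun v => (i * n + (v : ℕ), true)) ∈ cliqueCNF n k adj := by
  unfold cliqueCNF
  refine List.mem_append.2 (Or.inl (List.mem_append.2 (Or.inl ?_)))
  exact List.mem_map.2 ⟨i, List.mem_range.2 hi, rfl⟩

/-- The edge clause for `i ≠ j` and a non-adjacent (or equal) pair is an axiom of `cliqueCNF`. -/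
theorem edge_mem (k i j : ℕ) (hi : i < k) (hj : j < k) (hij : i ≠ j) (adj : Fin n → Fin n → Bool)
    (u v : Fin n) (huv : adj u v = false) :
    [(i * n + (u : ℕ), false), (j * n + (v : ℕ), false)] ∈ cliqueCNF n k adj := by
  unfold cliqueCNF
  refine List.mem_append.2 (Or.inr ?_)
  refine List.mem_flatMap.2 ⟨i, List.mem_range.2 hi, List.mem_flatMap.2 ⟨j, List.mem_range.2 hj,
    List.mem_flatMap.2 ⟨u, List.mem_finRange u, List.mem_flatMap.2 ⟨v, List.mem_finRange v, ?_⟩⟩⟩⟩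
  rw [if_pos ⟨hij, huv⟩]
  exact List.mem_singleton.2 rfl

/-- The block-0 member clause as a finset. -/
theorem toFinset_block0 : ((List.finRange n).map fun v => (0 * n + (v : ℕ), true)).toFinset = pos0 0 n := by
  ext ⟨a, b⟩
  rw [List.mem_toFinset, mem_pos0]
  simp [Fin.exists_iff]

/-- The block-1 member clause as a finset. -/
theorem toFinset_block1 : ((List.finRange n).map fun v => (1 * n + (v : ℕ), true)).toFinset = pos1 0 n := by
  ext ⟨a, b⟩
  rw [List.mem_toFinset, mem_pos1]
  simp [Fin.exists_iff]
  constructor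
  · rintro ⟨v, hv, rfl, rfl⟩; exact ⟨by omega, by omega, rfl⟩
  · rintro ⟨h1, h2, rfl⟩; exact ⟨a - n, by omega, by omega, rfl⟩

/-- An edge axiom as a finset. -/
theorem toFinset_edge (t s : ℕ) : [(0 * n + t, false), (1 * n + s, false)].toFinset = clE n t s := by
  simp [clE]

/-- Clauses of `φ` give members of `φ.clauseFinsets`. -/
theorem mem_clauseFinsets {φ : CNF ℕ} {c : Clause ℕ} (hc : c ∈ φ) : c.toFinset ∈ φ.clauseFinsets :=
  List.mem_map.2 ⟨c, hc, rfl⟩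

/-! ### Validity, refutation, regularity -/

/-- VALIDITY: every line of `refutation n` is justified (empty graph, `n ≥ 1`, `k ≥ 2`). -/
theorem refutation_isResDerivation {k : ℕ} (hn : 1 ≤ n) (hk : 2 ≤ k) :
    IsResDerivation (cliqueCNF n k fun _ _ => false) (refutation n) := by
  refine isResDerivation_map_range ?_ ?_ ?_
  · -- initial lines
    intro a ha hrule
    rcases region_cases hn ha with rfl | rfl | ⟨s, t, hs, ht, rfl⟩ | ⟨s, t, hs, ht, rfl⟩ | ⟨s, hs, rfl⟩
    · rw [line_zero, ← toFinset_block1]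
      exact mem_clauseFinsets (block_mem k 1 (by omega) _)
    · rw [line_one, ← toFinset_block0]
      exact mem_clauseFinsets (block_mem k 0 (by omega) _)
    · rw [lineE_spec hs ht, ← toFinset_edge]
      exact mem_clauseFinsets (edge_mem k 0 1 (by omega) (by omega) (by omega) _ ⟨t, ht⟩ ⟨s, hs⟩ rfl)
    · rw [lineR_spec hs ht] at hrule; cases hrule
    · rw [lineT_spec s] at hrule; cases hrule
  · -- resolution lines
    intro a ha i j v hrule
    rcases region_cases hn ha with rfl | rfl | ⟨s, t, hs, ht, rfl⟩ | ⟨s, t, hs, ht, rfl⟩ | ⟨s, hs, rfl⟩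
    · rw [line_zero] at hrule; cases hrule
    · rw [line_one] at hrule; cases hrule
    · rw [lineE_spec hs ht] at hrule; cases hrule
    · -- R-line (s,t): resolve on x_{0,t}
      have hsnt := idxR_lt hs ht
      rw [lineR_spec hs ht] at hrule ⊢
      simp only [ResRule.resolve.injEq] at hrule
      obtain ⟨rfl, rfl, rfl⟩ := hrule
      rw [lineE_spec hs ht]
      rcases Nat.eq_zero_or_pos t with rfl | htpos
      · simp only [if_true, line_one]
        refine ⟨by omega, by omega, ?_, ?_, ?_⟩
        · exact mem_pos0.2 ⟨le_rfl, hn, rfl⟩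
        · simp [clE]
        · rw [pos0_erase, clE_erase hn]; rfl
      · rw [if_neg (by omega)]
        obtain ⟨t', rfl⟩ : ∃ t', t = t' + 1 := ⟨t - 1, by omega⟩
        have e : 2 + n * n + (s * n + (t' + 1)) - 1 = 2 + n * n + (s * n + t') := by omega
        rw [e, lineR_spec hs (by omega)]
        refine ⟨by omega, by omega, ?_, ?_, ?_⟩
        · exact Finset.mem_union_left _ (mem_pos0.2 ⟨le_rfl, ht, rfl⟩)
        · simp [clE]
        · show clR n s (t' + 1) = (clR n s t').erase (t' + 1, true) ∪ (clE n (t' + 1) s).erase (t' + 1, false)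
          rw [clR, clR, clR_erase, clE_erase ht, Finset.union_assoc, Finset.union_idempotent]
    · -- T-line s: resolve on x_{1,s}
      rw [lineT_spec s] at hrule ⊢
      simp only [ResRule.resolve.injEq] at hrule
      obtain ⟨rfl, rfl, rfl⟩ := hrule
      have hsn := idxR_lt hs (show n - 1 < n by omega)
      rw [lineR_spec hs (show n - 1 < n by omega)]
      have hC : (line n (if s = 0 then 0 else 2 + 2 * (n * n) + s - 1)).clause = pos1 s n := by
        rcases Nat.eq_zero_or_pos s with rfl | hspos
        · simp [line_zero]
        · rw [if_neg (by omega)]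
          have e : 2 + 2 * (n * n) + s - 1 = 2 + 2 * (n * n) + (s - 1) := by omega
          rw [e, lineT_spec (s - 1), Nat.sub_add_cancel hspos]
      refine ⟨by split_ifs <;> omega, by omega, ?_, ?_, ?_⟩
      · rw [hC]; exact mem_pos1.2 ⟨le_rfl, by omega, rfl⟩
      · exact Finset.mem_union_right _ (Finset.mem_singleton_self _)
      · rw [hC, pos1_erase, clR, Nat.sub_add_cancel hn, pos0_self, Finset.empty_union,
          Finset.erase_singleton, Finset.union_empty]
  · -- no weakening lines
    intro a ha i hrule
    rcases region_cases hn ha with rfl | rfl | ⟨s, t, hs, ht, rfl⟩ | ⟨s, t, hs, ht, rfl⟩ | ⟨s, hs, rfl⟩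
    · rw [line_zero] at hrule; cases hrule
    · rw [line_one] at hrule; cases hrule
    · rw [lineE_spec hs ht] at hrule; cases hrule
    · rw [lineR_spec hs ht] at hrule; cases hrule
    · rw [lineT_spec s] at hrule; cases hrule

/-- `refutation n` refutes `Clique(∅ₙ, k)`. -/
theorem refutation_isResRefutation {k : ℕ} (hn : 1 ≤ n) (hk : 2 ≤ k) :
    IsResRefutation (cliqueCNF n k fun _ _ => false) (refutation n) := by
  refine ⟨refutation_isResDerivation hn hk, line n (2 + 2 * (n * n) + (n - 1)),
    List.mem_map.2 ⟨_, List.mem_range.2 (by omega), rfl⟩, ?_⟩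
  rw [lineT_spec (n - 1), Nat.sub_add_cancel hn]
  exact pos1_self n

/-- rank of a line: pivot + 1 for resolution lines, 0 otherwise -/
def rank (n a : ℕ) : ℕ := ((line n a).rule.pivot?.map (· + 1)).getD 0

/-- REGULARITY of `refutation n`, via the rank `pivot + 1`: along every DAG path the pivots are `n+s > … ` (outer chain) followed by `t > t-1 > …` (one inner chain), all `< n + s`. -/
theorem refutation_isRegular (hn : 1 ≤ n) : IsRegular (refutation n) := by
  refine isRegular_of_strictRank _ (rank n) ?_ ?_
  · intro a ha b hb
    have ha' : a < 2 + 2 * (n * n) + n := by simpa [refutation] using ha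
    simp only [refutation, List.getElem_map, List.getElem_range] at hb
    rcases region_cases hn ha' with rfl | rfl | ⟨s, t, hs, ht, rfl⟩ | ⟨s, t, hs, ht, rfl⟩ | ⟨s, hs, rfl⟩
    · simp [line_zero, ResLine.premises, ResRule.premises] at hb
    · simp [line_one, ResLine.premises, ResRule.premises] at hb
    · simp [lineE_spec hs ht, ResLine.premises, ResRule.premises] at hb
    · have hsnt := idxR_lt hs ht
      rw [lineR_spec hs ht] at hb
      simp only [ResLine.premises, ResRule.premises, List.mem_cons, List.not_mem_nil, or_false] at hb
      have hra : rank n (2 + n * n + (s * n + t)) = t + 1 := by simp [rank, lineR_spec hs ht, ResRule.pivot?]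
      rw [hra]
      rcases hb with rfl | rfl
      · rcases Nat.eq_zero_or_pos t with rfl | htpos
        · simp [rank, line_one, ResRule.pivot?]
        · rw [if_neg (by omega)]
          obtain ⟨t', rfl⟩ : ∃ t', t = t' + 1 := ⟨t - 1, by omega⟩
          have e : 2 + n * n + (s * n + (t' + 1)) - 1 = 2 + n * n + (s * n + t') := by omega
          rw [e]
          simp [rank, lineR_spec hs (show t' < n by omega), ResRule.pivot?]
      · simp [rank, lineE_spec hs ht, ResRule.pivot?]
    · rw [lineT_spec s] at hb
      simp only [ResLine.premises, ResRule.premises, List.mem_cons, List.not_mem_nil, or_false] at hb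
      have hra : rank n (2 + 2 * (n * n) + s) = n + s + 1 := by simp [rank, lineT_spec s, ResRule.pivot?]
      rw [hra]
      rcases hb with rfl | rfl
      · rcases Nat.eq_zero_or_pos s with rfl | hspos
        · simp [rank, line_zero, ResRule.pivot?]
        · rw [if_neg (by omega)]
          have e : 2 + 2 * (n * n) + s - 1 = 2 + 2 * (n * n) + (s - 1) := by omega
          rw [e]
          simp [rank, lineT_spec (s - 1), ResRule.pivot?]
          omega
      · simp [rank, lineR_spec hs (show n - 1 < n by omega), ResRule.pivot?]
        omega
  · intro a ha a' ha' v hv hv'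
    simp only [refutation, List.getElem_map, List.getElem_range] at hv hv'
    simp [rank, hv, hv']

/-- **Core witness.** For the empty graph (`adj ≡ false`) on `n ≥ 1` vertices and any `k ≥ 2`,
`Clique(∅ₙ, k)` has a REGULAR resolution refutation with `2n² + n + 2` lines. -/
theorem exists_short_regular_refutation {k : ℕ} (hn : 1 ≤ n) (hk : 2 ≤ k) :
    ∃ π : List (ResLine ℕ), IsResRefutation (cliqueCNF n k fun _ _ => false) π ∧ IsRegular π ∧
      π.length = 2 + 2 * (n * n) + n :=
  ⟨refutation n, refutation_isResRefutation hn hk, refutation_isRegular hn, length_refutation n⟩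

end validity


/-! ## Load-bearing analysis: each one-sided version of the crux is FALSE -/

/-- The crux restated through `cliqueCNF` (definitionally the route decl, see
`regularResolutionRung_iff_restated`). -/
def Restated : Prop :=
  ∃ ε : ℝ, 0 < ε ∧ ∃ n₀ : ℕ, ∀ n ≥ n₀, ∀ (G : SimpleGraph (Fin n)) [DecidableRel G.Adj],
    ∀ π₁ π₂ : List (ResLine ℕ),
      IsResRefutation (cliqueCNF n (Nat.clog 2 (n ^ 2)) fun u v => decide (G.Adj u v)) π₁ → IsRegular π₁ →
      IsResRefutation (cliqueCNF n (Nat.clog 2 (n ^ 2)) fun u v => decide (Gᶜ.Adj u v)) π₂ → IsRegular π₂ →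
      (n : ℝ) ^ (ε * Real.logb 2 n) ≤ max (π₁.length : ℝ) (π₂.length : ℝ)

/-- The route decl is definitionally `Restated`. -/
theorem regularResolutionRung_iff_restated :
    Summit.PneNP.PneNP.Theses.RamseyUncertifiable.RegularResolutionRung ↔ Restated := Iff.rfl

/-- **The shape of a refutation of the crux** (pure logic): a kill needs, for every `ε > 0` beyond
every `n₀`, a graph with SHORT regular refutations on BOTH sides simultaneously — necessarily a
`⌈2log₂ n⌉`-Ramsey graph (otherwise one of the two formulas is satisfiable and has no refutation). -/
theorem not_restated_iff :
    ¬ Restated ↔ ∀ ε : ℝ, 0 < ε → ∀ n₀ : ℕ, ∃ n ≥ n₀, ∃ (G : SimpleGraph (Fin n)) (_ : DecidableRel G.Adj),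
      ∃ π₁ π₂ : List (ResLine ℕ),
        IsResRefutation (cliqueCNF n (Nat.clog 2 (n ^ 2)) fun u v => decide (G.Adj u v)) π₁ ∧ IsRegular π₁ ∧
        IsResRefutation (cliqueCNF n (Nat.clog 2 (n ^ 2)) fun u v => decide (Gᶜ.Adj u v)) π₂ ∧ IsRegular π₂ ∧
        max (π₁.length : ℝ) (π₂.length : ℝ) < (n : ℝ) ^ (ε * Real.logb 2 n) := by
  unfold Restated
  push Not
  rfl

/-- `RegularResolutionRung` with the hypothesis on the COMPLEMENT side dropped (no `π₂`):
"every regular refutation of `Clique(G, ⌈2log₂ n⌉)` alone is quasi-polynomially long". -/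
def RegularResolutionRungWithoutComplement : Prop :=
  ∃ ε : ℝ, 0 < ε ∧ ∃ n₀ : ℕ, ∀ n ≥ n₀, ∀ (G : SimpleGraph (Fin n)) [DecidableRel G.Adj],
    ∀ π₁ : List (ResLine ℕ),
      IsResRefutation (cliqueCNF n (Nat.clog 2 (n ^ 2)) fun u v => decide (G.Adj u v)) π₁ → IsRegular π₁ →
      (n : ℝ) ^ (ε * Real.logb 2 n) ≤ (π₁.length : ℝ)

/-- `RegularResolutionRung` with the hypothesis on the GRAPH side dropped (no `π₁`). -/
def RegularResolutionRungWithoutGraph : Prop :=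
  ∃ ε : ℝ, 0 < ε ∧ ∃ n₀ : ℕ, ∀ n ≥ n₀, ∀ (G : SimpleGraph (Fin n)) [DecidableRel G.Adj],
    ∀ π₂ : List (ResLine ℕ),
      IsResRefutation (cliqueCNF n (Nat.clog 2 (n ^ 2)) fun u v => decide (Gᶜ.Adj u v)) π₂ → IsRegular π₂ →
      (n : ℝ) ^ (ε * Real.logb 2 n) ≤ (π₂.length : ℝ)

/-- Both one-sided versions are strengthenings of the crux. -/
theorem regularResolutionRung_of_withoutComplement (h : RegularResolutionRungWithoutComplement) :
    Summit.PneNP.PneNP.Theses.RamseyUncertifiable.RegularResolutionRung := by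
  obtain ⟨ε, hε, n₀, h⟩ := h
  exact regularResolutionRung_iff_restated.2
    ⟨ε, hε, n₀, fun n hn G _ π₁ π₂ h₁ r₁ _ _ => (h n hn G π₁ h₁ r₁).trans (le_max_left _ _)⟩

/-- The graph-side-dropped version is a strengthening of the crux. -/
theorem regularResolutionRung_of_withoutGraph (h : RegularResolutionRungWithoutGraph) :
    Summit.PneNP.PneNP.Theses.RamseyUncertifiable.RegularResolutionRung := by
  obtain ⟨ε, hε, n₀, h⟩ := h
  exact regularResolutionRung_iff_restated.2
    ⟨ε, hε, n₀, fun n hn G _ π₁ π₂ _ _ h₂ r₂ => (h n hn G π₂ h₂ r₂).trans (le_max_right _ _)⟩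

/-- Arithmetic of the witness: at `n = 2^m` the refutation length `2n² + n + 2` is eventually below
`n^{ε log₂ n} = 2^{ε m²}`. -/
theorem key_bound {ε : ℝ} (hε : 0 < ε) (n₀ : ℕ) :
    ∃ n : ℕ, n₀ ≤ n ∧ 1 ≤ n ∧ 2 ≤ Nat.clog 2 (n ^ 2) ∧
      ((2 + 2 * (n * n) + n : ℕ) : ℝ) < (n : ℝ) ^ (ε * Real.logb 2 n) := by
  obtain ⟨m, hm₀, hm3, hmε⟩ : ∃ m : ℕ, n₀ ≤ m ∧ 3 ≤ m ∧ 3 ≤ ε * m := by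
    refine ⟨n₀ + 3 + ⌈3 / ε⌉₊, by omega, by omega, ?_⟩
    have h1 : 3 / ε ≤ (⌈3 / ε⌉₊ : ℝ) := Nat.le_ceil _
    have h2 : (⌈3 / ε⌉₊ : ℝ) ≤ ((n₀ + 3 + ⌈3 / ε⌉₊ : ℕ) : ℝ) := by
      push_cast
      linarith [(Nat.cast_nonneg n₀ : (0 : ℝ) ≤ n₀)]
    have h3 : 3 / ε ≤ ((n₀ + 3 + ⌈3 / ε⌉₊ : ℕ) : ℝ) := h1.trans h2
    rw [div_le_iff₀ hε] at h3
    linarith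
  refine ⟨2 ^ m, hm₀.trans Nat.lt_two_pow_self.le, Nat.one_le_two_pow, ?_, ?_⟩
  · rw [← pow_mul, Nat.clog_pow _ _ (by norm_num)]
    omega
  · have hnR : ((2 ^ m : ℕ) : ℝ) = (2 : ℝ) ^ (m : ℝ) := by
      rw [Real.rpow_natCast]; push_cast; ring
    have hlog : Real.logb 2 ((2 ^ m : ℕ) : ℝ) = m := by
      rw [hnR, Real.logb_rpow (by norm_num) (by norm_num)]
    rw [hlog, hnR, ← Real.rpow_mul (by norm_num)]
    have hexp : ((3 * m : ℕ) : ℝ) ≤ (m : ℝ) * (ε * m) := by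
      push_cast
      have hm0 : (0 : ℝ) ≤ m := Nat.cast_nonneg m
      nlinarith
    have h8 : (2 : ℝ) ^ (3 * m) ≤ (2 : ℝ) ^ ((m : ℝ) * (ε * m)) := by
      rw [← Real.rpow_natCast]
      exact Real.rpow_le_rpow_of_exponent_le (by norm_num) hexp
    have hx : (8 : ℝ) ≤ (2 : ℝ) ^ m := by
      calc (8 : ℝ) = 2 ^ 3 := by norm_num
        _ ≤ 2 ^ m := pow_le_pow_right₀ (by norm_num) hm3
    have hpoly : (2 : ℝ) + 2 * (2 ^ m * 2 ^ m) + 2 ^ m < (2 : ℝ) ^ (3 * m) := by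
      have e : (2 : ℝ) ^ (3 * m) = 2 ^ m * (2 ^ m * 2 ^ m) := by ring
      rw [e]
      nlinarith [hx, mul_le_mul_of_nonneg_right hx (by positivity : (0 : ℝ) ≤ 2 ^ m * 2 ^ m),
        mul_le_mul_of_nonneg_left hx (by positivity : (0 : ℝ) ≤ 2 ^ m)]
    calc ((2 + 2 * (2 ^ m * 2 ^ m) + 2 ^ m : ℕ) : ℝ) = (2 : ℝ) + 2 * (2 ^ m * 2 ^ m) + 2 ^ m := by
          push_cast; ring
      _ < (2 : ℝ) ^ (3 * m) := hpoly
      _ ≤ _ := h8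

/-- **Load-bearing: the complement side.** Dropping `π₂` makes the crux FALSE: for the EMPTY graph
`G = ⊥` on `n = 2^m` vertices, `Clique(G, k)` has a regular refutation with `2n² + n + 2` lines
(blocks 0 and 1 cannot both be placed), far below `n^{ε log₂ n}`. Any proof of the crux must use
that `Ḡ` is also `k`-clique-free, i.e. that `G` is genuinely Ramsey. -/
theorem regularResolutionRung_false_without_complement : ¬ RegularResolutionRungWithoutComplement := by
  rintro ⟨ε, hε, n₀, h⟩
  obtain ⟨n, hn₀, hn1, hk, hlt⟩ := key_bound hε n₀
  obtain ⟨π, hπ, hreg, hlen⟩ := exists_short_regular_refutation (n := n) hn1 hk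
  have hle := h n hn₀ ⊥ π (by convert hπ using 2; funext u v; simp) hreg
  rw [hlen] at hle
  exact absurd (hle.trans_lt hlt) (lt_irrefl _)

/-- **Load-bearing: the graph side.** Symmetrically, dropping `π₁` makes the crux FALSE: take the
COMPLETE graph `G = ⊤`, whose complement is empty. -/
theorem regularResolutionRung_false_without_graph : ¬ RegularResolutionRungWithoutGraph := by
  rintro ⟨ε, hε, n₀, h⟩
  obtain ⟨n, hn₀, hn1, hk, hlt⟩ := key_bound hε n₀
  obtain ⟨π, hπ, hreg, hlen⟩ := exists_short_regular_refutation (n := n) hn1 hk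
  have hle := h n hn₀ ⊤ π (by convert hπ using 2; funext u v; simp) hreg
  rw [hlen] at hle
  exact absurd (hle.trans_lt hlt) (lt_irrefl _)

/-- For every `n ≥ 1` BOTH escape routes are realised — but by DIFFERENT graphs (`⊥` for the graph
side, `⊤` for the complement side); by Ramsey's theorem no graph on `n ≥ R(k,k)`… rather, no graph
has both `G` and `Ḡ` bipartite-trivially refutable: the `max` in the crux is exactly where
Ramsey-ness enters. -/
theorem both_sides_separately_short {n : ℕ} (hn : 1 ≤ n) {k : ℕ} (hk : 2 ≤ k) :
    (∃ π, IsResRefutation (cliqueCNF n k fun u v => decide ((⊥ : SimpleGraph (Fin n)).Adj u v)) π ∧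
        IsRegular π ∧ π.length = 2 + 2 * (n * n) + n) ∧
    (∃ π, IsResRefutation (cliqueCNF n k fun u v => decide ((⊤ : SimpleGraph (Fin n))ᶜ.Adj u v)) π ∧
        IsRegular π ∧ π.length = 2 + 2 * (n * n) + n) := by
  obtain ⟨π, hπ, hreg, hlen⟩ := exists_short_regular_refutation (n := n) (k := k) hn hk
  refine ⟨⟨π, ?_, hreg, hlen⟩, ⟨π, ?_, hreg, hlen⟩⟩
  · convert hπ using 2; funext u v; simp
  · convert hπ using 2; funext u v; simp


/-! ## Targets — cycle 2 (g3): the stubs of the three checked skeletons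

No `PICKED.md` yet; three lines have CHECKED skeletons (2026-08-16): `drc-selfrich-core`
(generation 2: stubs `stub_core`, `stub_partition`, `stub_fractional` = FRAC₂, `stub_bottleneck`),
`indelible-zero-banks` (`stub_promelRodlCore`, `stub_restrict`, `stub_oneWidthNF`,
`stub_bankEntropy`), `sound-path-bottleneck` (`stub_ramseyBiDenseCore`, `stub_restrictToInduced`,
`stub_soundPathCount`, `stub_biDenseTrapSparse`). Verdicts of this cycle (details below each):

**(A) `drc-selfrich-core` generation-1 `stub_fractional` (FRAC v1: minimal-trap SUM `≤ θ^{r/4}` down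
to `q' = |S|^{1-β}`) — FALSE**, in Lean modulo a standard host: `Targets.stubFractional_false_of_host :
FracHost → ¬ StubFractional` (sub-radar planted holes: `r+1` groups of `|S|^{1-β}/8` vertices, each
empty to one class of `W`; transversals are inclusion-minimal traps; weight `∏(|U_i|θ) ≥
((log₂n)²/8)^{r+1} > 1 > θ^r`). The generation-2 planner found the same design on paper (line card
§F1) and RESTATED the stub; the Lean record is filed as
`Theorems/RegularResolutionRung/Negative/StubFractionalV1FalseOfHost.lean`. Repair window of the
witness: every variant with an ABSOLUTE demand and `q' ≤ |S|^{1-β+η}`, `η < (1-β)/(3+4/r)`.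

**(B) generation-2 `stub_fractional` (FRAC₂, spread-COVER form: `∃ 𝓒` covering all traps with
`(Σ_C θ^{|C|})^4 ≤ (Mlog₂⁴n/q')^r`, `θ = log₂²n/q'`, `M = |S|^{1-β}`) — RESISTS.** Attacks run (paper):
(i) aligned transversal designs (any number `p > r` of classes, groups `< M`): the traps themselves are
a cover of cost `(aθ)^p ≤ (Mθ)^{r/2+1} < (Mθlog₂²n)^{r/4}` — absorbed by design; (ii) few classes +
generic padding: padding multiplies minimal-trap SUMS by `(mθe/g)^g` but is free for covers (cover by
the junk part); (iii) "hypergraph-matching transversals" — holes = unions of `s` out of `(r+1)s`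
mini-classes, pools for every `s`-subset, traps = perfect matchings × pools, per-coordinate
multiplicity `≈ (r+1)^s ≈ m^{β(1-1.44/log₂(er))}` for `s = β log₂m/log₂(e(r+1))`; by
`Targets.cover_cost_ge_of_spread` (LP duality, proved below) the uniform measure on these traps forces
cover cost `≥ min(f₀, ∏ f_l)` with `log₂ ∏ f_l ≈ (r+1)ℓ[β(1-1.44/log₂(er)) - η]` at `q' = M·m^η`,
which WOULD exceed the demand `-(r/4)ηℓ` for every `η < (4/3)β(1-o(1))` — but bi-density kills the
host: pools sharing a mini-class `P_i` jointly number `C(N-1,s-1)·a`, so lower BD (context `P_i`)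
forces either `|P_i| < M/s` (then richness `q ≤ s|P_i|2^{-r} ≤ M2^{-r}`, `q' < M`, and FRAC₂
self-trivialises: `Targets.frac2_trivial`) or `a ≤ M/C(N-1,s-1)`, which cancels the multiplicity
exactly (`(r+1)^s·a·e ≈ M·O(r e^{2-s}) < M`). General obstruction met by every attempt: lower BD
caps the junk usable against any context `X`, `|X| ≥ M`, at `< M` vertices IN TOTAL (all hole
patterns containing `X` together), while non-triviality (`q' > M log₂⁴ n`) keeps every trap context
above `M`; so per-coordinate multiplicity `< M` and the cover by the traps' junk parts costs
`≤ (Mθ)^{#junk} ≤ (Mθ)^{r/2+1}`. A kill needs a `θ`-spread trap measure supported on NON-aligned junk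
(many hole patterns per context class), i.e. `≳ M^{r/4} q'^{3r/4}` traps through no popular small
set — I found no BD-compatible construction; this is exactly the planner's "approximate design at
`r = Θ(log n)`" gap, confirmed adversarially.

**(B') ADVERSARIAL CHECK of the lead's inference "the affine witness kills `drc-selfrich-core` too"
(`Lines/sound-path-bottleneck-dead.md` §4, PICKED.md 2026-08-16T02:35) — it does NOT, as the stubs are written.**
The points/affine-hyperplanes graph `H_d` (and its random-block variant `H'`) kills `stub_biDenseTrapSparse`
because `IsTrap.dense` there is LOCAL (`∀ R ⊆ T ∪ B`): dependent `(r+1)`-sets of hyperplanes with independent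
`r`-subsets are sound minimal traps for `(W,T) = (Ω,∅)`, `(m/3)^r/(r+1)!` of them. Both drc versions of property 2
(FRAC v1 and FRAC₂) instead carry ABdRLNR21 Def. 6.1's GLOBAL precondition "`W` is `(r,q)`-dense":
`∀ R ⊆ S, |R| ≤ r → |N̂_W(R)| ≥ q` (p. 14: "`R` is not required to be a clique"), and `W = Ω` violates it for every
`r ≥ 3`: a dependent triple of hyperplanes `(a,b₁),(c,b₂),(a+c,b₃)` with `b₃ ≠ b₁+b₂` has EMPTY common
`Ω`-neighbourhood (and in `H_d` also empty common `P`-neighbourhood when `b₁+b₂+b₃ = 0`). A globally dense `W` in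
`H'` must draw its density from the random part (`W ⊇ P''`, `q ≤ |P''|2^{-r}`), and then no trap closes within the
cap: `|N̂_W(T∪B)| ≥ |P''|2^{-|T∪B|}(1-o(1)) ≥ |P''|2^{-(r/2+cap)} > δ^{cap}q/2 ≥ q'` since `log₂(1/δ) > 1`. So on
`H_d`/`H'` FRAC₂ holds (no traps for admissible `W`; `𝓒 = ∅`), FRAC v1 likewise; FRAC v1 is dead by the sub-radar
witness (A), not by `H_d`; **FRAC₂ is at present UNREFUTED** (it resists (A)-type designs by its cover form and
`H_d`-type designs by its global density precondition — the two preconditions are complementary: exact algebraic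
designs give spread traps but destroy global `r`-wise density, sub-radar plantings keep density but give only
aligned, cheaply covered traps). Whether `stub_bottleneck`'s Lemma 6.6 really delivers a GLOBALLY `(r,q)`-dense good
piece `W` (it does in ABdRLNR21: goodness is Def. 6.1 for all `R ⊆ V`, obtained from property 1 by the pigeonhole
over `t` pieces) is the point a lead should re-check before calling `drc-selfrich-core` dead; the lead's §4 remark
that refutations of `Clique(H',k)` force Case 2a on `Ω`-heavy pairs concerns pairs whose `W ⊆ Ω` is not good in
this sense.

**(C) `sound-path-bottleneck` `stub_biDenseTrapSparse` (minimal sound-trap SUM `≤ τ`,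
`τ < m^{-2ε log₂ m}/k`, parameters `∃ (L₀ r b t q q' p₁ τ)` chosen AFTER `H`) — FALSE ON PAPER (padded
transversal traps), for e.g. `(β,δ,C) = (1/10,1/3,10)`; full write-up
`Cruxes/RegularResolutionRung/StubBiDenseTrapSparseRefutation.md` (commit 0970458f6c44). Host: `G(m,½)` plus,
for EVERY `p ≤ β log₂ m/log₂(1/δ) + 1` and every hole depth `ρ = 2^{-j}`, a planted design (`p` classes of size
`mL²/(8β³ℓ³)`, `p` sub-radar groups `|U_i| = M/8`, `U_i`–`C_i` edges at density `ρ`) — `(M,1/3)`-bi-dense. Forced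
moves of the prover (explicit trap families of weight `≫ 1`): `q ≥ q'` (else `∅` is a trap); `p₁ ≤ 1/2`;
`p₁ ≥ 0.69εℓ²/q'` and `q' > refCount·M ≥ M` (coin term); `r ≥ 4εℓ` (Case-1 term), hence `t = O(1)`,
`b ≥ CrL/β`; GENERIC traps (`T,B,W` generic, `|W| = 0.7q'2^{⌊r/2⌋+b₀}`, `b₀ = ⌈⌈r/2⌉+log₂(q/q')+0.6⌉`) force
`q' < 3q·2^{-(b-⌈r/2⌉)}`, so `mθ ≥ 0.23εCℓ³t·2^{Q}`, `aθ ≥ 0.028εCℓ³t·2^{Q-βℓ}`, `Q = b-⌈r/2⌉+tr·log₂(1/δ)`. KILL: with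
`T = ∅`, the design `p = r+1`, `ρ = 2^{-j_*}` (`j_* = ⌈log₂(q/q')-b+r+1+log₂(3(r+1))⌉`, in range for every
admissible `b`) and sub-classes of size `c' = 0.7q'2^{r+g+j_*}/(r+1) ∈ [1.05, 2.1]·q2^r`, every
`B = {u_1..u_{r+1}} ∪ G` (`u_i ∈ U_i`, `G` ANY `g = b-r-2` generic vertices) is a minimal sound trap (closes at
`0.7q'`; dense via the missed class `≥ 1.03q`; dropping a generic doubles, dropping `u_i` revives `≥ 2.8q'`; every
vertex keeps `≥ 1/3` of every context), so `log₂ trapWeight(W,∅) ≥ (r+1)log₂(aθ) + g·log₂(mθ/4g) ≥ (b-1)Q -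
(r+1)βℓ - o(ℓ²) ≥ ℓ²[C²/t² - x(β + C/(2t) - CL)] - o(ℓ²) ≥ (C²/t²)ℓ² - o(ℓ²) > 0 > log₂ τ` whenever
`C(L - 1/2) > β` (`x = r/ℓ`, `L = log₂(1/δ)`): the SUM functional pays for each of the `C(m/4,g)` generic paddings
(`mθ ≫ 1` is forced), the drc planner's lesson §F1(ii) verbatim. REPAIR (line not dead): state the property in
spread-COVER form with a RELATIVE demand — the padded family is covered by its junk transversals at cost
`(Mθ)^{r+1}` — and let stub 3's Case 2a take covers (same union bound). An ABSOLUTE demand is separately squeezed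
by plain complete-hole transversals to `ε < β³/(54·C·log₂(1/δ))` (prover margin `max x(β-C/t+x/2-tLx) ≈
β³/(27CL)`, numerically 0.91× at `β=.1,C=10,δ=1/3`); and the docstring's parameter line needs `t > 8KC/β` (else
generic traps fit). Lean: not formalised (∃-parameters after `H` ⇒ a real-analysis case split; ≫ 2k lines).

**(D) `indelible-zero-banks` `stub_bankEntropy` (⇔ the transfer C⁺ "two-sided bi-dense ⇒
`log₂|π| ≥ ε log₂² m`" given `OneWidthNF`) — RESISTS; calibration.** Blow-ups `F[t]` of
`F = G(f,½)`, `f = m^{β'}`, `t = m^{1-β'}`, `β' > 2β`, are two-sided bi-dense at scale `m^{1-β}`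
(blobs are sub-radar; `|aᵀ(F-½J)b| ≤ O(√f)(m/f)√(|A||B|)`), `K_k`-free for `k = 2log₂ f + 3 ≤
(2β'+1)log₂ m`, and EASY up to `|I(G)|·k²m² ≤ #cliques(F)·poly ≤ 2^{(β'ℓ)²/2+O(ℓ)} = m^{β'²log₂ m/2+O(1)}`
(ABdRLNR21 Prop. 3.1; `I(F[t]) ≅ I(F)`), while hard to `m^{Ω(β'² log m)}` (a copy of `F` is induced;
Thm 5.1). So `ε(β,δ,C) ≤ 2β²(1+o(1))` is forced — consistent (`ε` existential). A kill of C⁺ needs an EASY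
two-sided bi-dense `K_{O(log m)}`-free family; every easy class known (colourable, bounded
homomorphic image, joins) fails lower or upper density at scale `m^{1-β}`, and recursion through
blow-ups reproduces the question one level down with worse `β`. `stub_oneWidthNF` (counting:
`|π|·(a/m)^h < 1`) and `stub_restrict` (restriction with provenance) check out on paper;
`stub_promelRodlCore` / `stub_ramseyBiDenseCore` are PR99 as printed (LPRT Lemma 11).

**(E) other stubs.** `stub_core` (drc): not cheaply attackable (no explicit threshold-Ramsey graphs;
union-bound constructions — `G(n,½)` ± gadgets, anti-twin 2-lifts `(i,s)~(j,t) ⇔ b_{ij}⊕s⊕t` — all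
contain random-like cores, one vertex per fibre); bookkeeping any proof must respect: SR with
`(c,γ)` in a `k`-clique-free `S` forces `c < 2` (greedy cliques) and, by averaging
`Σ_w C(d_w,r)/C(m,r)`, roughly `c ≤ γλ/log₂(1/(1-δ))` for `|S| = n^λ`; BD for PAIRS at polynomial
scale is not Erdős–Szemerédi (an empty pair `|A|=|B|=n^{0.9}` only forces `α ≳ 0.36 log₂ n`).
`stub_partition`: true for all parameters (finite averaging + Chernoff). `stub_bottleneck` (drc):
any `C₁ < 1/c` makes its FRAC₂ hypothesis vacuous and the stub false (Turán), so the announced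
`C₁ = 2t/min(c,1)` is forced; at it FRAC₂ fails on Turán/colourable hosts as it must.
`stub_soundPathCount`: Turán is lower-bi-dense only at scale `M ≈ 4m/k`, where `refCount·M > m ≥ q'`
makes the coin term `1` — no cheap counter-instance; lower-bi-dense at small scale + easy is the C⁺
question again.
-/

namespace Targets

/-- LP-duality direction for spread-cover statements (FRAC₂-type): if the traps `𝓣` carry weights
`μ ≥ 0` of total mass `1` such that, for every candidate cover element `C ∈ 𝓒`, the traps containing
`C` have mass `≤ θ^{|C|}/D`, then any `𝓒` covering `𝓣` (every trap contains a member of `𝓒`) costs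
`Σ_{C∈𝓒} θ^{|C|} ≥ D`. (A refutation of a spread-cover property = exhibiting such a `θ`-spread `μ`.) -/
theorem cover_cost_ge_of_spread {V : Type*} [DecidableEq V] (𝓣 𝓒 : Finset (Finset V))
    (μ : Finset V → ℝ) (θ D : ℝ) (hD : 0 < D)
    (hμ0 : ∀ B ∈ 𝓣, 0 ≤ μ B) (hμ1 : 𝓣.sum μ = 1)
    (hcover : ∀ B ∈ 𝓣, ∃ C ∈ 𝓒, C ⊆ B)
    (hspread : ∀ C ∈ 𝓒, (𝓣.filter fun B => C ⊆ B).sum μ ≤ θ ^ C.card / D) :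
    D ≤ 𝓒.sum fun C => θ ^ C.card := by
  -- 1 = Σ_B μ B ≤ Σ_B Σ_{C ∈ 𝓒, C ⊆ B} μ B = Σ_C Σ_{B ⊇ C} μ B ≤ Σ_C θ^|C| / D
  have h1 : (1 : ℝ) ≤ 𝓣.sum fun B => (𝓒.filter fun C => C ⊆ B).sum fun _ => μ B := by
    rw [← hμ1]
    refine Finset.sum_le_sum fun B hB => ?_
    obtain ⟨C, hC, hCB⟩ := hcover B hB
    have hmem : C ∈ 𝓒.filter fun C => C ⊆ B := Finset.mem_filter.2 ⟨hC, hCB⟩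
    calc μ B = ({C} : Finset (Finset V)).sum fun _ => μ B := by simp
      _ ≤ (𝓒.filter fun C => C ⊆ B).sum fun _ => μ B :=
        Finset.sum_le_sum_of_subset_of_nonneg (Finset.singleton_subset_iff.2 hmem)
          (fun _ _ _ => hμ0 B hB)
  have h2 : (𝓣.sum fun B => (𝓒.filter fun C => C ⊆ B).sum fun _ => μ B)
      = 𝓒.sum fun C => (𝓣.filter fun B => C ⊆ B).sum μ := by
    rw [Finset.sum_comm' (t' := 𝓒) (s' := fun C => 𝓣.filter fun B => C ⊆ B)]
    intro B C
    simp only [Finset.mem_filter]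
    tauto
  have h3 : (𝓒.sum fun C => (𝓣.filter fun B => C ⊆ B).sum μ) ≤ 𝓒.sum fun C => θ ^ C.card / D :=
    Finset.sum_le_sum fun C hC => hspread C hC
  have h4 : (𝓒.sum fun C => θ ^ C.card / D) = (𝓒.sum fun C => θ ^ C.card) / D := by
    rw [Finset.sum_div]
  have h5 : (1 : ℝ) ≤ (𝓒.sum fun C => θ ^ C.card) / D := by
    rw [← h4]; exact h1.trans (h2 ▸ h3)
  rwa [le_div_iff₀ hD, one_mul] at h5

/-- The spread-cover property FRAC₂ is VACUOUS in the regime where its demand is `≥ 1`: the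
one-element family `{∅}` covers every trap at cost `1`. -/
theorem frac2_trivial {V : Type*} [DecidableEq V] (Trap : Finset V → Prop) (θ X : ℝ) (r : ℕ)
    (hX : 1 ≤ X) :
    ∃ 𝓒 : Finset (Finset V), (∀ B, Trap B → ∃ C ∈ 𝓒, C ⊆ B) ∧
      (𝓒.sum fun C => θ ^ C.card) ^ 4 ≤ X ^ r :=
  ⟨{∅}, fun B _ => ⟨∅, Finset.mem_singleton_self _, Finset.empty_subset _⟩, by
    simpa using one_le_pow₀ hX⟩


/-- `stub_fractional` of `Lines/drc-selfrich-core.lean`, verbatim (FRAC for self-rich bi-dense cores). -/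
def StubFractional : Prop :=
    ∀ c γ β δ γ' C₁ : ℝ, 0 < c → 0 < γ → γ < β → β < 1 → 0 < δ → δ < 1 / 2 → 0 < γ' → 0 < C₁ →
    ∃ n₀ : ℕ, ∀ n ≥ n₀, ∀ (G : SimpleGraph (Fin n)) [DecidableRel G.Adj] (S : Finset (Fin n)),
      (n : ℝ) ^ γ' ≤ S.card →
      (∀ R ⊆ S, (R.card : ℝ) ≤ c * Real.logb 2 n →
        (S.card : ℝ) ^ (1 - γ) ≤ ((S.filter fun v => ∀ u ∈ R, G.Adj u v).card : ℝ)) →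
      (∀ A ⊆ S, ∀ B ⊆ S, (S.card : ℝ) ^ (1 - β) ≤ A.card → (S.card : ℝ) ^ (1 - β) ≤ B.card →
        δ * A.card * B.card ≤ (((A ×ˢ B).filter fun p => G.Adj p.1 p.2).card : ℝ) ∧
          (((A ×ˢ B).filter fun p => G.Adj p.1 p.2).card : ℝ) ≤ (1 - δ) * A.card * B.card) →
      (∀ (W T : Finset (Fin n)) (r cap : ℕ) (q q' θ : ℝ),
        W ⊆ S → T ⊆ S → Disjoint W T → G.IsClique (↑T : Set (Fin n)) → 2 * T.card ≤ r →
        Real.logb 2 n ≤ C₁ * r → ((cap + r : ℕ) : ℝ) ≤ c * Real.logb 2 n → (cap : ℝ) * min c 1 ≤ 3 * r →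
        (S.card : ℝ) ^ (1 - β) ≤ q' → q' ≤ δ ^ cap * q / 2 → 0 < θ → θ * q' ≤ Real.logb 2 n ^ 2 →
        (∀ R ⊆ S, R.card ≤ r → q ≤ ((W.filter fun v => ∀ u ∈ R, G.Adj u v).card : ℝ)) →
        (Finset.sum
            (S.powerset.filter fun B => B.card ≤ cap ∧ Disjoint T B ∧ Disjoint W B ∧
              ((W.filter fun v => ∀ u ∈ T ∪ B, G.Adj u v).card : ℝ) < q' ∧
              ∀ B' ∈ B.ssubsets, q' ≤ ((W.filter fun v => ∀ u ∈ T ∪ B', G.Adj u v).card : ℝ))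
            fun B => θ ^ B.card) ^ 4 ≤ θ ^ r)

/-- HOST HYPOTHESIS (not yet constructed in the tree; true for `G(n,½)` with `r+1` planted
sub-radar holes, and for the quadratic Cayley graph over `𝔽₂^{80r}` with planted holes — see the
module docstring). For infinitely many `r`, on `n = 2^{80r}` vertices: a set `S` (`|S| ≥ n^{1/2}`)
that is self-rich with `(c,γ) = (1/16, 1/8)` and bi-dense with `(β,δ) = (1/4, 1/4)` EXACTLY as the
stub demands, a set `W ⊆ S` covered by classes `C₀,…,C_r`, pairwise disjoint groups `U₀,…,U_r ⊆ S∖W`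
with `8|U_i| ≥ |S|^{3/4}`, no edges between `U_i` and `C_i`, every `≤ r`-subset of `S` has
`≥ 2·4^{r+1}|S|^{3/4}` common neighbours in `W`, and every `≤ r`-subset of `S` avoiding `U_i` has
`≥ |S|^{3/4}` common neighbours in `C_i`. -/
def FracHost : Prop :=
  ∀ n₀ : ℕ, ∃ r : ℕ, n₀ ≤ r ∧
    ∃ (G : SimpleGraph (Fin (2 ^ (80 * r)))) (_ : DecidableRel G.Adj)
      (S W : Finset (Fin (2 ^ (80 * r)))) (C U : Fin (r + 1) → Finset (Fin (2 ^ (80 * r)))),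
      ((2 ^ (80 * r) : ℕ) : ℝ) ^ (1 / 2 : ℝ) ≤ S.card ∧
      (∀ R ⊆ S, (R.card : ℝ) ≤ 1 / 16 * Real.logb 2 ((2 ^ (80 * r) : ℕ) : ℝ) →
        (S.card : ℝ) ^ (1 - 1 / 8 : ℝ) ≤ ((S.filter fun v => ∀ u ∈ R, G.Adj u v).card : ℝ)) ∧
      (∀ A ⊆ S, ∀ B ⊆ S, (S.card : ℝ) ^ (1 - 1 / 4 : ℝ) ≤ A.card → (S.card : ℝ) ^ (1 - 1 / 4 : ℝ) ≤ B.card →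
        1 / 4 * A.card * B.card ≤ (((A ×ˢ B).filter fun p => G.Adj p.1 p.2).card : ℝ) ∧
          (((A ×ˢ B).filter fun p => G.Adj p.1 p.2).card : ℝ) ≤ (1 - 1 / 4) * A.card * B.card) ∧
      W ⊆ S ∧ (∀ i, C i ⊆ W) ∧ (∀ w ∈ W, ∃ i, w ∈ C i) ∧
      (∀ i, U i ⊆ S) ∧ (∀ i, Disjoint (U i) W) ∧ (∀ i j, i ≠ j → Disjoint (U i) (U j)) ∧
      (∀ i, (S.card : ℝ) ^ (1 - 1 / 4 : ℝ) ≤ 8 * (U i).card) ∧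
      (∀ i, ∀ u ∈ U i, ∀ w ∈ C i, ¬ G.Adj u w) ∧
      (∀ R ⊆ S, R.card ≤ r →
        2 * 4 ^ (r + 1) * (S.card : ℝ) ^ (1 - 1 / 4 : ℝ) ≤ ((W.filter fun v => ∀ u ∈ R, G.Adj u v).card : ℝ)) ∧
      (∀ i, ∀ R ⊆ S, R.card ≤ r → Disjoint R (U i) →
        (S.card : ℝ) ^ (1 - 1 / 4 : ℝ) ≤ (((C i).filter fun v => ∀ u ∈ R, G.Adj u v).card : ℝ))

/-- **Counting core.** If `F` contains the image of every transversal of pairwise disjoint groups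
`U i` (`i : ι`), each with `|U i|·θ ≥ 2`, and `0 < θ < 1`, then `(Σ_{B∈F} θ^{|B|})^4 ≤ θ^r` fails
for `r ≥ 1`: the transversal images are distinct sets of size `|ι|`, so the sum is at least
`∏_i (|U i| θ) ≥ 1 > θ^r`. -/
theorem false_of_transversal_traps {V ι : Type*} [DecidableEq V] [Fintype ι] [DecidableEq ι]
    {F : Finset (Finset V)} {θ : ℝ} {r : ℕ} (U : ι → Finset V)
    (key : (F.sum fun B => θ ^ B.card) ^ 4 ≤ θ ^ r)
    (hθ0 : 0 < θ) (hθ1 : θ < 1) (hr : 1 ≤ r)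
    (hdisj : ∀ i j, i ≠ j → Disjoint (U i) (U j))
    (hbig : ∀ i, 2 ≤ (U i).card * θ)
    (hmem : ∀ f : ι → V, (∀ i, f i ∈ U i) → Finset.univ.image f ∈ F) : False := by
  -- transversals and their images
  set Tr : Finset (ι → V) := Fintype.piFinset U with hTr
  have hTr_mem : ∀ f ∈ Tr, ∀ i, f i ∈ U i := fun f hf => Fintype.mem_piFinset.1 hf
  have hinj_f : ∀ f ∈ Tr, Function.Injective f := by
    intro f hf i j hij
    by_contra hne
    have h1 : f i ∈ U i := hTr_mem f hf i
    have h2 : f i ∈ U j := hij ▸ hTr_mem f hf j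
    exact Finset.disjoint_left.1 (hdisj i j hne) h1 h2
  have hcard_img : ∀ f ∈ Tr, (Finset.univ.image f).card = Fintype.card ι := fun f hf => by
    rw [Finset.card_image_of_injective _ (hinj_f f hf), Finset.card_univ]
  have hinjOn : Set.InjOn (fun f : ι → V => Finset.univ.image f) ↑Tr := by
    intro f hf g hg hfg
    funext i
    have hfi : f i ∈ Finset.univ.image g := by
      have : f i ∈ Finset.univ.image f := Finset.mem_image_of_mem f (Finset.mem_univ i)
      simpa [hfg] using this
    obtain ⟨j, -, hj⟩ := Finset.mem_image.1 hfi
    by_cases hji : j = i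
    · subst hji; exact hj.symm
    · exact absurd (hj ▸ hTr_mem g hg j) (Finset.disjoint_left.1 (hdisj i j (Ne.symm hji)) (hTr_mem f hf i))
  -- the sum over F dominates the sum over transversal images
  have hsub : Tr.image (fun f : ι → V => Finset.univ.image f) ⊆ F := by
    intro B hB
    obtain ⟨f, hf, rfl⟩ := Finset.mem_image.1 hB
    exact hmem f (hTr_mem f hf)
  have hsum : (Tr.card : ℝ) * θ ^ Fintype.card ι ≤ F.sum fun B => θ ^ B.card := by
    calc (Tr.card : ℝ) * θ ^ Fintype.card ι
        = Tr.sum (fun f => θ ^ (Finset.univ.image f).card) := by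
          rw [Finset.sum_congr rfl (fun f hf => by rw [hcard_img f hf]), Finset.sum_const, nsmul_eq_mul]
      _ = (Tr.image (fun f : ι → V => Finset.univ.image f)).sum (fun B => θ ^ B.card) :=
          (Finset.sum_image (f := fun B : Finset V => θ ^ B.card) hinjOn).symm
      _ ≤ F.sum fun B => θ ^ B.card :=
          Finset.sum_le_sum_of_subset_of_nonneg hsub (fun B _ _ => pow_nonneg hθ0.le _)
  -- the transversal weight is ∏ (|U i| θ) ≥ 1
  have hprod : (1 : ℝ) ≤ (Tr.card : ℝ) * θ ^ Fintype.card ι := by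
    have hTrcard : (Tr.card : ℝ) = Finset.univ.prod fun i => ((U i).card : ℝ) := by
      rw [hTr, Fintype.card_piFinset]; push_cast; rfl
    rw [hTrcard, ← Finset.card_univ, ← Finset.prod_const, ← Finset.prod_mul_distrib]
    calc (1 : ℝ) = Finset.univ.prod (fun _ : ι => (1 : ℝ)) := Finset.prod_const_one.symm
      _ ≤ Finset.univ.prod (fun i => ((U i).card : ℝ) * θ) :=
          Finset.prod_le_prod (fun _ _ => zero_le_one) (fun i _ => by linarith [hbig i])
  have h1 : (1 : ℝ) ≤ F.sum fun B => θ ^ B.card := hprod.trans hsum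
  have h4 : (1 : ℝ) ≤ (F.sum fun B => θ ^ B.card) ^ 4 := one_le_pow₀ h1
  have hθr : θ ^ r < 1 := pow_lt_one₀ hθ0.le hθ1 (by omega)
  linarith

/-- **`stub_fractional` is false modulo the host.** Instantiate the stub at
`(c, γ, β, δ, γ', C₁) = (1/16, 1/8, 1/4, 1/4, 1/2, 80)`, take the host at `n = 2^{80r} ≥ n₀`, and
apply FRAC to `W`, `T = ∅`, `r`, `cap = r+1`, `q = 2·4^{r+1}|S|^{3/4}`, `q' = |S|^{3/4}`,
`θ = (log₂ n)²/q' = (80r)²/q'`: every side condition holds (with equality in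
`q' ≤ δ^{cap} q/2` and `θ q' ≤ (log₂ n)²`), every transversal of the groups is an inclusion-minimal
trap, and `false_of_transversal_traps` finishes (`|U_i| θ ≥ (80 r)²/8 ≥ 2`, `θ < 1` because
`(80r)² < 2^{30r} ≤ n^{3/8} ≤ |S|^{3/4}`). -/
theorem stubFractional_false_of_host (hH : FracHost) : ¬ StubFractional := by
  intro hSF
  obtain ⟨n₀, hn₀⟩ := hSF (1 / 16) (1 / 8) (1 / 4) (1 / 4) (1 / 2) 80 (by norm_num) (by norm_num)
    (by norm_num) (by norm_num) (by norm_num) (by norm_num) (by norm_num) (by norm_num)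
  obtain ⟨r, hr, G, hdec, S, W, C, U, hS, hSR, hBD, hWS, hCW, hcov, hUS, hUW, hUU, hUcard, hhole,
    hrich, hrich1⟩ := hH (max n₀ 1)
  have hr1 : 1 ≤ r := le_trans (le_max_right _ _) hr
  have hrn₀ : n₀ ≤ r := le_trans (le_max_left _ _) hr
  -- the parameters (`n = 2^{80 r}` is kept literal: `G`, `S`, … depend on it)
  have hrn : r ≤ 2 ^ (80 * r) :=
    (Nat.lt_two_pow_self).le.trans (Nat.pow_le_pow_right (by norm_num) (by omega))
  have hn₀n : 2 ^ (80 * r) ≥ n₀ := hrn₀.trans hrn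
  have hnR : ((2 ^ (80 * r) : ℕ) : ℝ) = (2 : ℝ) ^ (80 * r) := by push_cast; ring
  have hlog : Real.logb 2 ((2 ^ (80 * r) : ℕ) : ℝ) = 80 * r := by
    rw [hnR, Real.logb_pow, Real.logb_self_eq_one (by norm_num : (1 : ℝ) < 2)]; push_cast; ring
  have hn1 : (1 : ℝ) ≤ ((2 ^ (80 * r) : ℕ) : ℝ) := by exact_mod_cast Nat.one_le_two_pow
  have hn12 : (1 : ℝ) ≤ ((2 ^ (80 * r) : ℕ) : ℝ) ^ (1 / 2 : ℝ) := Real.one_le_rpow hn1 (by norm_num)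
  have hScard : (1 : ℝ) ≤ S.card := hn12.trans hS
  set q' : ℝ := (S.card : ℝ) ^ (1 - 1 / 4 : ℝ) with hq'
  have hq'pos : 0 < q' := Real.rpow_pos_of_pos (by linarith) _
  set θ : ℝ := Real.logb 2 ((2 ^ (80 * r) : ℕ) : ℝ) ^ 2 / q' with hθ
  have hrR : (1 : ℝ) ≤ r := by exact_mod_cast hr1
  have hlogpos : 0 < Real.logb 2 ((2 ^ (80 * r) : ℕ) : ℝ) := by rw [hlog]; linarith
  have hθpos : 0 < θ := div_pos (pow_pos hlogpos 2) hq'pos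
  -- θ < 1 :  (80 r)² < 2^{30 r} ≤ n^{3/8} ≤ |S|^{3/4} = q'
  have hθlt : θ < 1 := by
    rw [hθ, div_lt_one hq'pos, hlog]
    have hnat : (80 * r) ^ 2 < 2 ^ (30 * r) := by
      have hr2 : r < 2 ^ r := Nat.lt_two_pow_self
      have hA : r * r < 2 ^ r * 2 ^ r := Nat.mul_lt_mul'' hr2 hr2
      calc (80 * r) ^ 2 = 6400 * (r * r) := by ring
        _ < 6400 * (2 ^ r * 2 ^ r) := (Nat.mul_lt_mul_left (by norm_num)).2 hA
        _ ≤ 2 ^ 13 * (2 ^ r * 2 ^ r) := Nat.mul_le_mul_right _ (by norm_num)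
        _ = 2 ^ (13 + 2 * r) := by rw [pow_add, two_mul, pow_add]
        _ ≤ 2 ^ (30 * r) := Nat.pow_le_pow_right (by norm_num) (by omega)
    have h1 : ((80 * r : ℕ) : ℝ) ^ 2 < (2 : ℝ) ^ (30 * r) := by exact_mod_cast hnat
    have h2 : (2 : ℝ) ^ (30 * r) ≤ q' := by
      have h3 : (((2 ^ (80 * r) : ℕ) : ℝ) ^ (1 / 2 : ℝ)) ^ (1 - 1 / 4 : ℝ) ≤ q' :=
        Real.rpow_le_rpow (by positivity) hS (by norm_num)
      rw [← Real.rpow_mul (by positivity), hnR] at h3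
      have h4 : ((2 : ℝ) ^ (80 * r)) ^ ((1 / 2 : ℝ) * (1 - 1 / 4)) = (2 : ℝ) ^ (30 * r) := by
        rw [← Real.rpow_natCast, ← Real.rpow_natCast, ← Real.rpow_mul (by norm_num)]
        congr 1; push_cast; ring
      rw [h4] at h3
      exact h3
    have h5 : ((80 : ℝ) * r) ^ 2 = ((80 * r : ℕ) : ℝ) ^ 2 := by push_cast; ring
    rw [h5]
    exact h1.trans_le h2
  -- the factor bound |U i| θ ≥ 2
  have hbig : ∀ i, 2 ≤ ((U i).card : ℝ) * θ := by
    intro i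
    have hfac : q' / 8 * θ ≤ ((U i).card : ℝ) * θ :=
      mul_le_mul_of_nonneg_right (by linarith [hUcard i]) hθpos.le
    have hval : q' / 8 * θ = (80 * r) ^ 2 / 8 := by rw [hθ, hlog]; field_simp
    have h800 : (2 : ℝ) ≤ (80 * r) ^ 2 / 8 := by nlinarith [hrR]
    linarith
  -- FRAC applied to the planted configuration: `T = ∅`, `cap = r + 1`, `q = 2·4^{r+1} q'`
  have key := hn₀ (2 ^ (80 * r)) hn₀n G S hS hSR hBD W ∅ r (r + 1) (2 * 4 ^ (r + 1) * q') q' θ hWS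
    (Finset.empty_subset _) (Finset.disjoint_empty_right _) (by simp) (by simp) (by rw [hlog])
    (by rw [hlog]; push_cast; linarith) (by rw [min_eq_left (by norm_num)]; push_cast; linarith)
    le_rfl
    (by
      rw [show (1 / 4 : ℝ) ^ (r + 1) * (2 * 4 ^ (r + 1) * q') / 2 = ((1 / 4 : ℝ) * 4) ^ (r + 1) * q' by
        rw [mul_pow]; ring]
      norm_num)
    hθpos (by rw [hθ, div_mul_cancel₀ _ hq'pos.ne']) hrich
  -- every transversal of the groups `U i` is an inclusion-minimal trap
  refine false_of_transversal_traps U key hθpos hθlt hr1 hUU hbig ?_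
  intro f hf
  have hfinj : Function.Injective f := by
    intro i j hij
    by_contra hne
    exact Finset.disjoint_left.1 (hUU i j hne) (hf i) (hij ▸ hf j)
  have hBS : Finset.univ.image f ⊆ S := by
    intro x hx
    obtain ⟨i, -, rfl⟩ := Finset.mem_image.1 hx
    exact hUS i (hf i)
  have hBcard : (Finset.univ.image f).card = r + 1 := by
    rw [Finset.card_image_of_injective _ hfinj, Finset.card_univ, Fintype.card_fin]
  refine Finset.mem_filter.2 ⟨Finset.mem_powerset.2 hBS, hBcard.le, Finset.disjoint_empty_left _,
    ?_, ?_, ?_⟩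
  · -- `B` avoids `W`
    refine Finset.disjoint_left.2 fun v hvW hvB => ?_
    obtain ⟨i, -, rfl⟩ := Finset.mem_image.1 hvB
    exact Finset.disjoint_left.1 (hUW i) (hf i) hvW
  · -- `B` is a trap: no common neighbour in `W` (every `w ∈ C i` misses `f i`)
    have h0 : (W.filter fun v => ∀ u ∈ ∅ ∪ Finset.univ.image f, G.Adj u v) = ∅ := by
      refine Finset.filter_eq_empty_iff.2 fun v hv hall => ?_
      obtain ⟨i, hi⟩ := hcov v hv
      have hfi : f i ∈ ∅ ∪ Finset.univ.image f :=
        Finset.mem_union_right _ (Finset.mem_image_of_mem f (Finset.mem_univ i))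
      exact hhole i (f i) (hf i) v hi (hall (f i) hfi)
    rw [h0, Finset.card_empty, Nat.cast_zero]
    exact hq'pos
  · -- `B` is minimal: dropping `f i` frees the class `C i`
    intro B' hB'
    rw [Finset.mem_ssubsets] at hB'
    obtain ⟨x, hxB, hxB'⟩ := Finset.exists_of_ssubset hB'
    obtain ⟨i, -, rfl⟩ := Finset.mem_image.1 hxB
    have hB'R : B' ⊆ (Finset.univ.image f).erase (f i) := fun y hy =>
      Finset.mem_erase.2 ⟨fun h => hxB' (h ▸ hy), hB'.1 hy⟩
    have hRS : (Finset.univ.image f).erase (f i) ⊆ S := (Finset.erase_subset _ _).trans hBS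
    have hRcard : ((Finset.univ.image f).erase (f i)).card ≤ r := by
      rw [Finset.card_erase_of_mem hxB, hBcard]; omega
    have hRU : Disjoint ((Finset.univ.image f).erase (f i)) (U i) := by
      refine Finset.disjoint_left.2 fun y hyR hyU => ?_
      obtain ⟨hyne, hyB⟩ := Finset.mem_erase.1 hyR
      obtain ⟨j, -, rfl⟩ := Finset.mem_image.1 hyB
      by_cases hji : j = i
      · exact hyne (by rw [hji])
      · exact Finset.disjoint_left.1 (hUU j i hji) (hf j) hyU
    calc q' ≤ (((C i).filter fun v => ∀ u ∈ (Finset.univ.image f).erase (f i), G.Adj u v).card : ℝ) :=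
          hrich1 i _ hRS hRcard hRU
      _ ≤ ((W.filter fun v => ∀ u ∈ ∅ ∪ B', G.Adj u v).card : ℝ) := by
          exact_mod_cast Finset.card_le_card fun v hv => by
            rw [Finset.mem_filter] at hv ⊢
            exact ⟨hCW i hv.1, fun u hu => hv.2 u (hB'R (by simpa using hu))⟩


end Targets

/-! ## Line `indelible-zero-banks` — drefute g4 (2026-08-16, seat `refuter-drefute-stmt-PneNP-9818-g4-0`; prose only)

Registered skeleton `Lines/indelible_zero_banks.lean` (sha 40f94228…): stubs `stub_soundPathCount` (orphan, unused by the
composition), `stub_restrict` (LANDED p81469), `stub_oneWidthNF` (LANDED p80743), `stub_bankEntropy` (the bet =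
`BoundedOneWidthLB` ⇔ C⁺ = `BiDenseRegularLB` through the landed normal form). Fourth drefute pass: 0 stub-false,
0 stub-misstated, 4 survived. Landed/pending from this pass:
* `Theorems/RegularResolutionRung/Negative/BoundedOneWidthLBFalseWithoutLower.lean` (p85568):
  `boundedOneWidthLB_false_without_lower : ¬ BoundedOneWidthLBWithoutLower` — the bet with `BiDense` weakened to
  `UpperDense` is FALSE (empty graph, `M = 1`, `k = 2`, this file's `refutation m` re-landed as `Negative.refutation`,
  whose one-width is ≤ 2: `card_negSupport_line_le_two`). LOWER density is load-bearing.
* Whether UPPER density is load-bearing is OPEN (Turán / joins already violate lower density at scale `m^{1-β}`;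
  ABdRLNR21's clique-denseness is one-sided); SYMMETRY is load-bearing on paper (irreflexive bi-dense tournament has the
  empty graph's clause set); the ONE-WIDTH bound is not (⇔ C⁺).
* Bet analysis (no kill): abundance ratio `k/ω ≤ C·log₂(1/δ)/β` is bounded; `Sp_d` maximal odd cliques `{x,y,x+y}`,
  span-refusal ⇒ exact flats (no global traps), residual read-set alignment = eager immunisation, rigidity at `k = ω+1`
  by cut-and-paste; counting-certified (Plotkin / long-code Cayley) hosts closed. Details:
  `Cruxes/RegularResolutionRung/NegativeNotes-stub_bankEntropy-g4.md`.
-/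

end Summit.PneNP.PneNP.Cruxes.RegularResolutionRung.Disproof
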